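import Mathlib
import HarnessLib
import Summits.NavierStokesRegularity.NavierStokesRegularity.Theorems.HalfSpaceWindowDoorCirculationCarryingRigidityAxisCirculationDynamics
import Summits.NavierStokesRegularity.NavierStokesRegularity.Theorems.HalfSpaceWindowDoorCirculationCarryingRigidityGaussExtremalTilting
import Literature.Analysis.FluidPDE.MeridianReduction
import Literature.Analysis.FluidPDE.KNSSSwirlTransport
import Literature.Analysis.FluidPDE.AxisymQuotientEquations

/-!
# Route `HalfSpaceWindowDoor`, crux `CirculationCarryingRigidity` (stmt-NavierStokesRegularity-25311) —
# line `cone_sweep`, Step 1: the FLUX SUBSOLUTION of a coned time-only profile and its size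

LEAD ns-hsw-p1 g9 (cell pub-ns-dss), `--supports stmt-NavierStokesRegularity-25311 --as helper`; card
`Cruxes/CirculationCarryingRigidity/Lines/cone_sweep.md`; consumed by `…ConeSweeping` (Step 2).

Setting: a door-class profile (`‖v(s)‖_∞ ≤ C/√(−s)`, continuous, unit-viscosity Oseen-mild, divergence-free) with `ω₃ = ⟪curl v, e₃⟫ ≥ 0`
and the pointwise cone `‖ω_h‖ ≤ K·ω₃`.  The axis circulation `Γ(r,z,s) = ∮_{S(r,z)} v·e_θ dl` (`circ`, = `∫_{D(r,z)} ω₃`) obeys the circle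
law `∂ₛΓ = Γ_rr − r⁻¹Γ_r + Γ_zz − T` (tree `…AxisCirculationDynamics.deriv_circ_s_eq`); here:

* `tiltCirc_le_of_cone` — the pointwise cone gives the circle-averaged cone `∮|ω_h| dl ≤ K∮ω₃ dl`;
* `neg_circleTerm_le` (STEP 1) — `−T ≤ (C(1+K)/√(−s))·∮ω₃ dl = (B/√(−s)) Γ_r`: the vertical vorticity is a density transported
  horizontally at speed `≤ B/√(−s)`, `B = C(1+K)` (the speed of vortex-line/plane intersections), so `Γ` is a SUBSOLUTION of
  `∂ₛ − [∂ᵣᵣ − r⁻¹∂ᵣ + ∂_zz] − (B/√(−s))∂ᵣ`;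
* size: `circ_le_linear` (Stokes, `Γ ≤ 2πrC/√(−s)`), `vortCirc_le`, `circ_le_sq` (`Γ ≤ πr²M` under `ω₃ ≤ M`), `omega3_le_of_rate`
  (`ω₃ ≤ (4K₁+1)/(−s)` from the class gradient rate), `tube_bddAbove` (the tube-boundary circulations `Γ(R₁√(−s'),z',s')` are `≤ 2πR₁C`);
* barrier calculus for Step 2: `barrier_deriv_aux`, `hasDerivAt_invSqrt_mul`, `hasFDerivAt_horizSq`, `quad_sub_sq_le`, `norm_radialDrift_le`.

WHAT THIS IS NOT: not a statement about Navier–Stokes regularity; door statements concern HYPOTHETICAL blow-up profiles (KNSS ancient mild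
solutions).  No item is closed by this file.
-/

noncomputable section

-- the summit and its single sub-problem share the name (CONVENTIONS §1), as in every Theorems file
set_option linter.dupNamespace false

namespace Summit.NavierStokesRegularity.NavierStokesRegularity.Theorems.HalfSpaceWindowDoorCirculationCarryingRigidityConeFluxSubsolution

open MeasureTheory Set Function Filter Topology InnerProductSpace
open scoped RealInnerProductSpace InnerProductSpace Laplacian
open Literature.Analysis Literature.Analysis.FluidPDE Literature.Analysis.UnboundedOperators
open Summit.NavierStokesRegularity.NavierStokesRegularity.Theses.HalfSpaceWindowDoor
open Summit.NavierStokesRegularity.NavierStokesRegularity.Theorems.HalfSpaceWindowDoorCirculationCarryingRigidityDefs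
  (InDoorClass SignE3 e3)
open Summit.NavierStokesRegularity.NavierStokesRegularity.Theorems.AxisTwistDoorAveragedConeLiouvilleDefs
  (cylPt eT circ vortCirc tiltCirc circleTerm)
open Summit.NavierStokesRegularity.NavierStokesRegularity.Theorems.AveragedConeLiouville.CircleStokes
  (hasDerivAt_circ deriv_circ_eq_vortCirc inner_e3)
open Summit.NavierStokesRegularity.NavierStokesRegularity.Theorems.AveragedConeLiouville.CircMonotone
  (circ_zero circ_mono circ_nonneg vortCirc_nonneg)
open Summit.NavierStokesRegularity.NavierStokesRegularity.Theorems.AxisTwistDoorAveragedConeLiouvilleCircleToolkit (abs_circ_le)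
open Summit.NavierStokesRegularity.NavierStokesRegularity.Theorems.AxisTwistDoorAveragedConeLiouvilleCylFrame
  (continuous_cylPt_θ continuous_horizontal)
open Summit.NavierStokesRegularity.NavierStokesRegularity.Theorems.HalfSpaceWindowDoorCirculationCarryingRigidityAxisCirculation
  (contDiff_circF isSmoothSpaceTimeOn_circF isSmoothSpaceTimeOn_of_class fderiv_circF_eR laplacian_circF hasDerivAt_circF_time)
open Summit.NavierStokesRegularity.NavierStokesRegularity.Theorems.HalfSpaceWindowDoorCirculationCarryingRigidityAxisCirculationDynamics
  (abs_circleTerm_le_cone deriv_circ_s_eq)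
open Summit.NavierStokesRegularity.NavierStokesRegularity.Theorems.PoloidalWindowDoorPoloidalWindowRigidityClassSpaceTimeRates
  (exists_fderiv_rate_of_class')
open Summit.NavierStokesRegularity.NavierStokesRegularity.Theorems.PoloidalWindowDoorPoloidalWindowRigidityWindow
  (isTypeIAncientMild_of_class)

variable {C : ℝ} {v : ℝ → EuclideanSpace ℝ (Fin 3) → EuclideanSpace ℝ (Fin 3)}
/-! ### Bridges between the two crux vocabularies -/

/-- The closed-hemisphere sign in AxisTwistDoor's spelling. -/
theorem signE3_atd (hsign : SignE3 v) :
    Summit.NavierStokesRegularity.NavierStokesRegularity.Theorems.AxisTwistDoorAveragedConeLiouvilleDefs.SignE3 v :=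
  fun s hs y => hsign s hs y

/-- The norm of the horizontal part: `‖w − ⟪w,e₃⟫e₃‖ = √(w₀² + w₁²)`. -/
theorem norm_horizontalPart (w : EuclideanSpace ℝ (Fin 3)) :
    ‖w - ⟪w, Summit.NavierStokesRegularity.NavierStokesRegularity.Theorems.AxisTwistDoorAveragedConeLiouvilleDefs.e3⟫ •
        Summit.NavierStokesRegularity.NavierStokesRegularity.Theorems.AxisTwistDoorAveragedConeLiouvilleDefs.e3‖ =
      Real.sqrt (w 0 ^ 2 + w 1 ^ 2) := by
  rw [inner_e3, EuclideanSpace.norm_eq, Fin.sum_univ_three]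
  congr 1
  simp [Summit.NavierStokesRegularity.NavierStokesRegularity.Theorems.AxisTwistDoorAveragedConeLiouvilleDefs.e3]

/-- A slice of a door-class profile is `C¹` (indeed smooth). -/
theorem contDiff_one_slice (hv : InDoorClass C v) {s : ℝ} (hs : s < 0) : ContDiff ℝ 1 (v s) :=
  ((isSmoothSpaceTimeOn_of_class hv.1 hv.2.1 hv.2.2.1 hv.2.2.2).contDiff_slice hs).of_le (by norm_cast)

/-- The Type-I constant of a door-class profile is non-negative. -/
theorem typeI_const_nonneg (hv : InDoorClass C v) : 0 ≤ C := by
  have hsq : 0 < Real.sqrt (-(-1 : ℝ)) := by norm_num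
  have h := hv.1 (-1) (by norm_num) 0
  by_contra hC
  push Not at hC
  have : C / Real.sqrt (-(-1 : ℝ)) < 0 := div_neg_of_neg_of_pos hC hsq
  linarith [norm_nonneg (v (-1) 0)]

/-- **Pointwise cone ⇒ circle-averaged cone**: `∮|ω_h| dl ≤ K ∮ω₃ dl` on every axis circle. -/
theorem tiltCirc_le_of_cone (hv : InDoorClass C v) {K : ℝ}
    (hcone : ∀ s < 0, ∀ x, Real.sqrt ((curl (v s) x 0) ^ 2 + (curl (v s) x 1) ^ 2) ≤ K * curl (v s) x 2)
    {s : ℝ} (hs : s < 0) {r : ℝ} (hr : 0 ≤ r) (z : ℝ) : tiltCirc v r z s ≤ K * vortCirc v r z s := by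
  have hv1 := contDiff_one_slice hv hs
  have hωc : Continuous fun θ => curl (v s) (cylPt r θ z) := by
    have hD : Continuous (fderiv ℝ (v s)) := hv1.continuous_fderiv one_ne_zero
    have e : curl (v s) = fun x => curlCLM (fderiv ℝ (v s) x) := by funext x; exact curl_eq_curlCLM (v s) x
    rw [e]
    exact (curlCLM.continuous.comp hD).comp (continuous_cylPt_θ r z)
  unfold tiltCirc vortCirc
  rw [← intervalIntegral.integral_const_mul]
  refine intervalIntegral.integral_mono_on (by positivity) ?_ ?_ fun θ _ => ?_
  · exact (((continuous_horizontal.comp hωc).norm).mul continuous_const).intervalIntegrable _ _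
  · exact (((hωc.inner continuous_const).mul continuous_const).const_mul K).intervalIntegrable _ _
  · rw [norm_horizontalPart, inner_e3]
    have h := hcone s hs (cylPt r θ z)
    have := mul_le_mul_of_nonneg_right h hr
    linarith

/-! ### Step 1: the circle term under the cone -/

/-- **Step 1.**  Under the cone and the Type-I rate, `−T ≤ (C(1+K)/√(−s))·∮ω₃ dl` on every axis circle. -/
theorem neg_circleTerm_le (hv : InDoorClass C v) (hsign : SignE3 v) {K : ℝ}
    (hcone : ∀ s < 0, ∀ x, Real.sqrt ((curl (v s) x 0) ^ 2 + (curl (v s) x 1) ^ 2) ≤ K * curl (v s) x 2)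
    {s : ℝ} (hs : s < 0) {r : ℝ} (hr : 0 ≤ r) (z : ℝ) :
    -circleTerm v r z s ≤ C * (1 + K) / Real.sqrt (-s) * vortCirc v r z s := by
  have hsq : 0 < Real.sqrt (-s) := Real.sqrt_pos.2 (neg_pos.2 hs)
  have hC : 0 ≤ C := typeI_const_nonneg hv
  have h := abs_circleTerm_le_cone (contDiff_one_slice hv hs) (signE3_atd hsign s hs) hr (fun θ => hv.1 s hs _)
    (div_nonneg hC hsq.le) (tiltCirc_le_of_cone hv hcone hs hr z)
  have h2 : -circleTerm v r z s ≤ |circleTerm v r z s| := neg_le_abs _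
  calc -circleTerm v r z s ≤ (1 + K) * (C / Real.sqrt (-s)) * vortCirc v r z s := h2.trans h
    _ = C * (1 + K) / Real.sqrt (-s) * vortCirc v r z s := by ring

/-! ### Size of `Γ`: linear (Stokes) and quadratic (vorticity rate) bounds -/

/-- Stokes: `Γ(r,z,s) ≤ 2πr·C/√(−s)`. -/
theorem circ_le_linear (hv : InDoorClass C v) {s : ℝ} (hs : s < 0) {r : ℝ} (hr : 0 ≤ r) (z : ℝ) :
    circ v r z s ≤ 2 * Real.pi * r * (C / Real.sqrt (-s)) := by
  rcases hr.eq_or_lt with h | h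
  · rw [← h, circ_zero]; simp
  · exact (le_abs_self _).trans (abs_circ_le h fun θ => hv.1 s hs _)

/-- The vertical flux through a circle is at most `2πr` times the vorticity bound. -/
theorem vortCirc_le (hv : InDoorClass C v) {s : ℝ} (hs : s < 0) {M : ℝ} (hM : ∀ x, curl (v s) x 2 ≤ M)
    {r : ℝ} (hr : 0 ≤ r) (z : ℝ) : vortCirc v r z s ≤ 2 * Real.pi * r * M := by
  have hv1 := contDiff_one_slice hv hs
  have hωc : Continuous fun θ => curl (v s) (cylPt r θ z) := by
    have hD : Continuous (fderiv ℝ (v s)) := hv1.continuous_fderiv one_ne_zero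
    have e : curl (v s) = fun x => curlCLM (fderiv ℝ (v s) x) := by funext x; exact curl_eq_curlCLM (v s) x
    rw [e]
    exact (curlCLM.continuous.comp hD).comp (continuous_cylPt_θ r z)
  unfold vortCirc
  have h : ∫ θ in (0 : ℝ)..(2 * Real.pi), ⟪curl (v s) (cylPt r θ z),
      Summit.NavierStokesRegularity.NavierStokesRegularity.Theorems.AxisTwistDoorAveragedConeLiouvilleDefs.e3⟫ * r ≤
      ∫ θ in (0 : ℝ)..(2 * Real.pi), M * r := by
    refine intervalIntegral.integral_mono_on (by positivity) ?_ ?_ fun θ _ => ?_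
    · exact ((hωc.inner continuous_const).mul continuous_const).intervalIntegrable _ _
    · exact continuous_const.intervalIntegrable _ _
    · rw [inner_e3]; exact mul_le_mul_of_nonneg_right (hM _) hr
  refine h.trans ?_
  rw [intervalIntegral.integral_const, smul_eq_mul]
  nlinarith [Real.pi_pos]

/-- Quadratic bound: `Γ(r,z,s) ≤ πr²·M` when `ω₃(s,·) ≤ M` (`Γ(0) = 0`, `Γ_r = ∮ω₃ ≤ 2πrM`). -/
theorem circ_le_sq (hv : InDoorClass C v) {s : ℝ} (hs : s < 0) {M : ℝ} (hM : ∀ x, curl (v s) x 2 ≤ M)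
    {r : ℝ} (hr : 0 ≤ r) (z : ℝ) : circ v r z s ≤ Real.pi * r ^ 2 * M := by
  have hv1 := contDiff_one_slice hv hs
  -- `g(ρ) = Γ(ρ) − πρ²M` is non-increasing on `[0, ∞)`
  have hp : ∀ ρ : ℝ, HasDerivAt (fun ρ : ℝ => ρ ^ 2) (2 * ρ) ρ := fun ρ => by simpa using hasDerivAt_pow 2 ρ
  have hd : ∀ ρ : ℝ, HasDerivAt (fun ρ => circ v ρ z s - Real.pi * ρ ^ 2 * M) (vortCirc v ρ z s - Real.pi * (2 * ρ) * M) ρ :=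
    fun ρ => (hasDerivAt_circ v hv1 ρ z).sub (((hp ρ).const_mul Real.pi).mul_const M)
  have hanti : AntitoneOn (fun ρ => circ v ρ z s - Real.pi * ρ ^ 2 * M) (Ici 0) := by
    refine antitoneOn_of_deriv_nonpos (convex_Ici 0) ?_ ?_ fun ρ hρ => ?_
    · exact (continuous_iff_continuousAt.2 fun ρ => (hd ρ).continuousAt).continuousOn
    · intro ρ _
      exact (hd ρ).differentiableAt.differentiableWithinAt
    · rw [interior_Ici] at hρ
      rw [(hd ρ).deriv]
      have := vortCirc_le hv hs hM (le_of_lt hρ) z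
      nlinarith
  have h := hanti (self_mem_Ici : (0:ℝ) ∈ Ici 0) (mem_Ici.2 hr) hr
  simp only [circ_zero] at h
  nlinarith [h]

/-! ### Step 2: the sweeping lemma -/

/-- The set of tube-boundary circulations `{Γ(R₁√(−s'), z', s') : s' ≤ s₁, z'}` is bounded above by `2πR₁C` and below by `0`. -/
theorem tube_bddAbove (hv : InDoorClass C v) {R₁ : ℝ} (hR₁ : 0 ≤ R₁) {s₁ : ℝ} (hs₁ : s₁ < 0) :
    BddAbove {m : ℝ | ∃ s' : ℝ, s' ≤ s₁ ∧ ∃ z' : ℝ, m = circ v (R₁ * Real.sqrt (-s')) z' s'} ∧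
    ∀ m ∈ {m : ℝ | ∃ s' : ℝ, s' ≤ s₁ ∧ ∃ z' : ℝ, m = circ v (R₁ * Real.sqrt (-s')) z' s'}, m ≤ 2 * Real.pi * R₁ * C := by
  have key : ∀ m ∈ {m : ℝ | ∃ s' : ℝ, s' ≤ s₁ ∧ ∃ z' : ℝ, m = circ v (R₁ * Real.sqrt (-s')) z' s'}, m ≤ 2 * Real.pi * R₁ * C := by
    rintro m ⟨s', hs', z', rfl⟩
    have hs'0 : s' < 0 := lt_of_le_of_lt hs' hs₁
    have hsq : 0 < Real.sqrt (-s') := Real.sqrt_pos.2 (neg_pos.2 hs'0)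
    have h := circ_le_linear hv hs'0 (mul_nonneg hR₁ hsq.le) z'
    calc circ v (R₁ * Real.sqrt (-s')) z' s' ≤ 2 * Real.pi * (R₁ * Real.sqrt (-s')) * (C / Real.sqrt (-s')) := h
      _ = 2 * Real.pi * R₁ * C := by field_simp
  exact ⟨⟨2 * Real.pi * R₁ * C, key⟩, key⟩

/-- Scalar bookkeeping for the barrier's time derivative (`a = √(−t)`, `c = √(−s₀)`, `T = −t = a²`). -/
theorem barrier_deriv_aux (A a c T : ℝ) (ha : 0 < a) (hc : 0 < c) (hT : a ^ 2 = T) :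
    A * (-(-(1 / (2 * a)) * c) / (a * c) ^ 2) = A * (a * c)⁻¹ / (2 * T) := by
  subst hT
  field_simp

/-! ### Barrier calculus used in Step 2 (`…ConeSweeping`) -/

/-- `ω₃ ≤ (4K₁ + 1)/(−s)` from the class gradient rate `‖∇v(s)‖ ≤ K₁/(−s)` (`‖curl‖ ≤ 4‖∇v‖`). -/
theorem omega3_le_of_rate {K₁ : ℝ} (hK₁ : ∀ s < 0, ∀ x, ‖fderiv ℝ (v s) x‖ ≤ K₁ / (-s)) {s : ℝ} (hs : s < 0)
    (x : EuclideanSpace ℝ (Fin 3)) : curl (v s) x 2 ≤ (4 * K₁ + 1) / (-s) := by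
  have h1 : |curl (v s) x 2| ≤ ‖curl (v s) x‖ := by
    rw [← Real.norm_eq_abs]; exact PiLp.norm_apply_le (curl (v s) x) 2
  have h2 : ‖curl (v s) x‖ ≤ 4 * ‖fderiv ℝ (v s) x‖ := norm_curl_le_four_mul _ _
  have h3 := hK₁ s hs x
  have h5 : 4 * (K₁ / (-s)) ≤ (4 * K₁ + 1) / (-s) := by
    rw [← mul_div_assoc]
    exact div_le_div_of_nonneg_right (by linarith) (neg_pos.2 hs).le
  have h6 := (abs_le.1 h1).2
  calc curl (v s) x 2 ≤ ‖curl (v s) x‖ := h6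
    _ ≤ 4 * ‖fderiv ℝ (v s) x‖ := h2
    _ ≤ 4 * (K₁ / (-s)) := by gcongr
    _ ≤ (4 * K₁ + 1) / (-s) := h5

/-- Time derivative of `τ ↦ (√(−τ)·√(−s₀))⁻¹` at `t < 0`. -/
theorem hasDerivAt_invSqrt_mul {t s₀ : ℝ} (ht : t < 0) (hs₀ : s₀ < 0) :
    HasDerivAt (fun τ : ℝ => (Real.sqrt (-τ) * Real.sqrt (-s₀))⁻¹)
      (-(-(1 / (2 * Real.sqrt (-t))) * Real.sqrt (-s₀)) / (Real.sqrt (-t) * Real.sqrt (-s₀)) ^ 2) t := by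
  have hsqt : 0 < Real.sqrt (-t) := Real.sqrt_pos.2 (neg_pos.2 ht)
  have hsq₀ : 0 < Real.sqrt (-s₀) := Real.sqrt_pos.2 (neg_pos.2 hs₀)
  have h1 : HasDerivAt (fun τ : ℝ => Real.sqrt (-τ)) (-(1 / (2 * Real.sqrt (-t)))) t := by
    have := ((hasDerivAt_neg t).sqrt (by linarith))
    convert this using 1; ring
  exact (h1.mul_const _).inv (mul_ne_zero hsqt.ne' hsq₀.ne')

/-- Spatial derivative of `y ↦ y₀² + y₁²` (written with products). -/
theorem hasFDerivAt_horizSq (x : EuclideanSpace ℝ (Fin 3)) :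
    HasFDerivAt (fun y : EuclideanSpace ℝ (Fin 3) => y 0 * y 0 + y 1 * y 1)
      ((x 0 • EuclideanSpace.proj (𝕜 := ℝ) (0 : Fin 3) + x 0 • EuclideanSpace.proj (𝕜 := ℝ) (0 : Fin 3)) +
        (x 1 • EuclideanSpace.proj (𝕜 := ℝ) (1 : Fin 3) + x 1 • EuclideanSpace.proj (𝕜 := ℝ) (1 : Fin 3))) x := by
  have h0 := (EuclideanSpace.proj (𝕜 := ℝ) (0 : Fin 3) : EuclideanSpace ℝ (Fin 3) →L[ℝ] ℝ).hasFDerivAt (x := x)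
  have h1 := (EuclideanSpace.proj (𝕜 := ℝ) (1 : Fin 3) : EuclideanSpace ℝ (Fin 3) →L[ℝ] ℝ).hasFDerivAt (x := x)
  exact (h0.mul h0).add (h1.mul h1)

/-- `2πρa − Aρ²/u ≤ π²a²u/A` for `A, u > 0` (the barrier dominates the linear Stokes growth). -/
theorem quad_sub_sq_le {A u : ℝ} (hA : 0 < A) (hu : 0 < u) (ρ a : ℝ) :
    2 * Real.pi * ρ * a - A * ρ ^ 2 / u ≤ Real.pi ^ 2 * a ^ 2 * u / A := by
  have e : Real.pi ^ 2 * a ^ 2 * u / A - (2 * Real.pi * ρ * a - A * ρ ^ 2 / u) = (A * ρ - Real.pi * a * u) ^ 2 / (A * u) := by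
    field_simp
    ring
  have : 0 ≤ (A * ρ - Real.pi * a * u) ^ 2 / (A * u) := by positivity
  linarith

/-- The radial drift `(2/r − B/√(−t)) e_r` has norm `≤ (2/R₁ + B)/√(−s₁)` off the tube `{r ≤ R₁√(−t)}` for `t ≤ s₁ < 0`. -/
theorem norm_radialDrift_le {B R₁ s₁ t : ℝ} (hB : 0 ≤ B) (hR₁ : 0 < R₁) (hs₁ : s₁ < 0) (hts : t ≤ s₁)
    {x : EuclideanSpace ℝ (Fin 3)} (hx : R₁ * Real.sqrt (-t) < cylRadius x) :
    ‖(2 / cylRadius x - B / Real.sqrt (-t)) • Literature.Analysis.FluidPDE.eR x‖ ≤ (2 / R₁ + B) / Real.sqrt (-s₁) := by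
  have ht : t < 0 := lt_of_le_of_lt hts hs₁
  have hsqt : 0 < Real.sqrt (-t) := Real.sqrt_pos.2 (neg_pos.2 ht)
  have hsq₁ : 0 < Real.sqrt (-s₁) := Real.sqrt_pos.2 (neg_pos.2 hs₁)
  set ρ := cylRadius x with hρ
  have hρpos : 0 < ρ := lt_of_le_of_lt (by positivity) hx
  have hn : ‖Literature.Analysis.FluidPDE.eR x‖ ≤ 1 := Literature.Analysis.FluidPDE.norm_eR_le_one x
  have h1 : |2 / ρ - B / Real.sqrt (-t)| ≤ 2 / ρ + B / Real.sqrt (-t) := by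
    have ha : 0 ≤ 2 / ρ := by positivity
    have hb' : 0 ≤ B / Real.sqrt (-t) := by positivity
    rw [abs_le]; constructor <;> linarith
  have h2 : 2 / ρ ≤ 2 / (R₁ * Real.sqrt (-s₁)) := by
    refine div_le_div_of_nonneg_left (by norm_num) (by positivity) ?_
    refine le_trans ?_ hx.le
    exact mul_le_mul_of_nonneg_left (Real.sqrt_le_sqrt (by linarith)) hR₁.le
  have h3 : B / Real.sqrt (-t) ≤ B / Real.sqrt (-s₁) :=
    div_le_div_of_nonneg_left hB hsq₁ (Real.sqrt_le_sqrt (by linarith))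
  rw [norm_smul, Real.norm_eq_abs]
  calc |2 / cylRadius x - B / Real.sqrt (-t)| * ‖Literature.Analysis.FluidPDE.eR x‖
      ≤ (2 / ρ + B / Real.sqrt (-t)) * 1 := mul_le_mul h1 hn (norm_nonneg _) (by positivity)
    _ ≤ 2 / (R₁ * Real.sqrt (-s₁)) + B / Real.sqrt (-s₁) := by linarith
    _ = (2 / R₁ + B) / Real.sqrt (-s₁) := by field_simp

end Summit.NavierStokesRegularity.NavierStokesRegularity.Theorems.HalfSpaceWindowDoorCirculationCarryingRigidityConeFluxSubsolution

end
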